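import Summits.CriticalPhenomena.Ising3DConformalLimit.Theorems.InversionUpgradeNormalised.Negative.SixPointWitness

/-!
# `InversionUpgradeNormalised` (item stmt-CriticalPhenomena-1982): four-point conformal covariance does NOT propagate to six points (part II)

Negative knowledge about the crux
`Summit.CriticalPhenomena.Ising3DConformalLimit.Theses.HyperoctahedralRP.InversionUpgradeNormalised`
(standing crux disprover, cycle 2, D-0016); witness `sixFamily Δ` of `Negative/SixPointWitness.lean`.

* `sixFamily_invIdentity_of_ne_six`: the inversion identity holds at every order `n ≠ 6` (at
  `n = 4` with the non-Gaussian covariant connected part `-harm`);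
* `sixFamily_not_invIdentity_six`: it fails at order `6` for every `Δ > 0` — at `(e, 2e, …, 6e)`
  it would need `((120/707)³)^Δ = (720²/210³)^Δ`;
* `fourPoint_does_not_propagate`, `not_inversionUpgrade_from_low_orders`: MODEL-BLIND, the
  four-point identity (indeed all orders `≤ 5`) with (H3)–(H6), `U₄ ≢ 0` and the Lebowitz sign does
  not give `IsInversionCovariant Δ`. So a four-point theorem closes the crux only together with an
  all-orders mechanism; the tree has one on the Gaussian locus only
  (`HasPointwiseScalingLimit.eq_pairingSum_of_limitConnectedFour_eq_zero`).

Theorem-only file.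
-/

noncomputable section

namespace Summit.CriticalPhenomena.Ising3DConformalLimit.InversionUpgradeNormalisedNegative

open Literature.Probability.LatticeModels Literature.Barriers.CriticalPhenomena
open Set Function EuclideanGeometry ScaleNotMoebius Finset

/-- Griffiths-I shape at four points: `S₄ ≥ W₁ + W₂ ≥ 0`. [folklore] -/
theorem sixFamily_four_nonneg (Δ : ℝ) (x : Fin 4 → EuclideanSpace ℝ (Fin 3)) : 0 ≤ sixFamily Δ 4 x := by
  by_cases hx : Function.Injective x
  · rw [sixFamily_four, if_pos hx, wick_eq]
    have h1 := (W1_pos Δ hx).le; have h2 := (W2_pos Δ hx).le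
    have h3 := harm_le_W3 Δ hx
    linarith
  · rw [sixFamily_four, if_neg hx]

/-! ## Inversion: covariant at every order except six -/

/-- **Inversion covariance holds at EVERY order `n ≠ 6`** (in particular at `n = 4`, with the
non-Gaussian covariant connected part `-harm`). [folklore] -/
theorem sixFamily_invIdentity_of_ne_six (Δ : ℝ) {n : ℕ} (hn : n ≠ 6)
    (x : Fin n → EuclideanSpace ℝ (Fin 3)) (hx : ∀ i, x i ≠ 0) :
    sixFamily Δ n (fun i => inversion 0 1 (x i)) = (∏ i, ‖x i‖ ^ (2 * Δ)) * sixFamily Δ n x := by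
  match n, x, hx, hn with
  | 0, x, _, _ =>
    have h : (fun i => inversion 0 1 (x i)) = x := funext fun i => i.elim0
    rw [h]
    simp [sixFamily]
  | 1, _, _, _ => simp [sixFamily]
  | 2, x, hx, _ =>
    rw [sixFamily_two, sixFamily_two, Fin.prod_univ_two]
    exact twoPt_inversion Δ (hx 0) (hx 1)
  | 3, _, _, _ => simp [sixFamily]
  | 4, x, hx, _ =>
    have hinj := injective_comp_iff (inversion_injective (0 : EuclideanSpace ℝ (Fin 3)) one_ne_zero) x
    by_cases h : Function.Injective x
    · rw [sixFamily_four, sixFamily_four, if_pos (hinj.2 h), if_pos h, wick_inversion Δ hx,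
        harm_inversion Δ hx h, mul_sub]
    · rw [sixFamily_four, sixFamily_four, if_neg (mt hinj.1 h), if_neg h, mul_zero]
  | 5, _, _, _ => simp [sixFamily]
  | 6, _, _, hn => exact absurd rfl hn
  | (n + 7), _, _, _ => simp [sixFamily]

/-- `sqSum6 (e, 2e, …, 6e) = 210`. [folklore] -/
theorem sqSum6_config6 : sqSum6 config6 = 210 := by
  simp only [sqSum6, Fin.sum_univ_six, config6, norm_axisPt_sub_axisPt]
  simp
  norm_num

/-- `sqSum6 (e, e/2, …, e/6) = 707/120`. [folklore] -/
theorem sqSum6_inversion_config6 : sqSum6 (fun i => inversion 0 1 (config6 i)) = 707 / 120 := by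
  simp only [sqSum6, Fin.sum_univ_six, inversion_config6, norm_axisPt_sub_axisPt]
  simp
  norm_num

/-- `∏ ‖k e‖^{2Δ} = 720^{2Δ}` for `k = 1, …, 6`. [folklore] -/
theorem prod_norm_config6 (Δ : ℝ) : (∏ i, ‖config6 i‖ ^ (2 * Δ)) = (720 : ℝ) ^ (2 * Δ) := by
  rw [Real.finsetProd_rpow _ _ (fun i _ => norm_nonneg _)]
  congr 1
  simp only [Fin.prod_univ_six, config6, norm_axisPt]
  simp
  norm_num [abs_of_pos]

/-- **The six-point identity FAILS** for every `Δ > 0`: at `(e, 2e, …, 6e)` the Wick parts match but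
the bumps would need `(707/120)^{-3Δ} = 720^{2Δ}·210^{-3Δ}`, i.e. `((120/707)³)^Δ = (720²/210³)^Δ`,
and `(120/707)³ ≈ 0.0049 < 0.056 ≈ 720²/210³`. [folklore] -/
theorem sixFamily_not_invIdentity_six {Δ : ℝ} (hΔ : 0 < Δ) :
    ¬ ∀ x : Fin 6 → EuclideanSpace ℝ (Fin 3), (∀ i, x i ≠ 0) →
      sixFamily Δ 6 (fun i => inversion 0 1 (x i)) = (∏ i, ‖x i‖ ^ (2 * Δ)) * sixFamily Δ 6 x := by
  intro h
  have key := h config6 config6_ne_zero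
  have hinj' : Function.Injective (fun i => inversion 0 1 (config6 i)) :=
    (inversion_injective (0 : EuclideanSpace ℝ (Fin 3)) one_ne_zero).comp config6_injective
  rw [sixFamily_six, sixFamily_six, if_pos hinj', if_pos config6_injective,
    wick6_inversion Δ config6_ne_zero, mul_sub] at key
  have key2 : bump6 Δ (fun i => inversion 0 1 (config6 i)) =
      (∏ i, ‖config6 i‖ ^ (2 * Δ)) * bump6 Δ config6 := by linarith
  rw [bump6, bump6, sqSum6_inversion_config6, sqSum6_config6, prod_norm_config6] at key2
  -- key2 : (707/120)^(-(3Δ)) = 720^(2Δ) * 210^(-(3Δ))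
  have e1 : (707 / 120 : ℝ) ^ (-(3 * Δ)) = ((120 / 707 : ℝ) ^ (3:ℝ)) ^ Δ := by
    rw [Real.rpow_neg (by norm_num), ← Real.inv_rpow (by norm_num), inv_div,
      ← Real.rpow_mul (by norm_num)]
  have e2 : (720 : ℝ) ^ (2 * Δ) * (210 : ℝ) ^ (-(3 * Δ)) = ((720 : ℝ) ^ (2:ℝ) / (210 : ℝ) ^ (3:ℝ)) ^ Δ := by
    rw [Real.div_rpow (by positivity) (by positivity), ← Real.rpow_mul (by norm_num),
      ← Real.rpow_mul (by norm_num), Real.rpow_neg (by norm_num), div_eq_mul_inv]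
  have hlt : ((120 / 707 : ℝ) ^ (3:ℝ)) < (720 : ℝ) ^ (2:ℝ) / (210 : ℝ) ^ (3:ℝ) := by
    rw [show (3:ℝ) = ((3:ℕ):ℝ) by norm_num, show (2:ℝ) = ((2:ℕ):ℝ) by norm_num,
      Real.rpow_natCast, Real.rpow_natCast, Real.rpow_natCast]
    norm_num
  have lt : ((120 / 707 : ℝ) ^ (3:ℝ)) ^ Δ < ((720 : ℝ) ^ (2:ℝ) / (210 : ℝ) ^ (3:ℝ)) ^ Δ :=
    Real.rpow_lt_rpow (by positivity) hlt hΔ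
  rw [e1, e2] at key2
  exact lt.ne key2

/-- Hence the witness is not inversion covariant (only the order-`6` clause fails). [folklore] -/
theorem sixFamily_not_isInversionCovariant {Δ : ℝ} (hΔ : 0 < Δ) : ¬ IsInversionCovariant Δ (sixFamily Δ) :=
  fun h => sixFamily_not_invIdentity_six hΔ (h 6)


/-- **Four-point covariance does not propagate (model-blind)**: for every `Δ > 0` there is a
normalised, non-degenerate, Euclidean-invariant, scale-covariant family with `U₄ ≢ 0`, `U₄ ≤ 0`,
satisfying the inversion identity at every order `n ≠ 6` and violating it at order `6`.
[folklore] -/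
theorem fourPoint_does_not_propagate {Δ : ℝ} (hΔ : 0 < Δ) :
    ∃ S : CorrFamily 3, (∀ n z, z ∉ NonCoincident 3 n → S n z = 0) ∧ IsNondegenerateTwoPoint S ∧
      IsEuclideanInvariant S ∧ IsScaleCovariant Δ S ∧ HasNontrivialU4 S ∧
      (∀ x, limitConnectedFour S x ≤ 0) ∧
      (∀ n, n ≠ 6 → ∀ x : Fin n → EuclideanSpace ℝ (Fin 3), (∀ i, x i ≠ 0) →
        S n (fun i => inversion 0 1 (x i)) = (∏ i, ‖x i‖ ^ (2 * Δ)) * S n x) ∧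
      ¬ (∀ x : Fin 6 → EuclideanSpace ℝ (Fin 3), (∀ i, x i ≠ 0) →
        S 6 (fun i => inversion 0 1 (x i)) = (∏ i, ‖x i‖ ^ (2 * Δ)) * S 6 x) :=
  ⟨sixFamily Δ, sixFamily_eq_zero_of_not_mem hΔ.ne', sixFamily_isNondegenerateTwoPoint Δ,
    sixFamily_isEuclideanInvariant Δ, sixFamily_isScaleCovariant Δ, sixFamily_hasNontrivialU4 Δ,
    limitConnectedFour_sixFamily_nonpos Δ, fun _ hn x hx => sixFamily_invIdentity_of_ne_six Δ hn x hx,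
    sixFamily_not_invIdentity_six hΔ⟩

/-- In particular "inversion covariance at all orders `n ≤ 5`" (let alone `n = 4`) together with
(H3)–(H6), `U₄ ≢ 0` and the Lebowitz sign does not imply `IsInversionCovariant Δ`. [folklore] -/
theorem not_inversionUpgrade_from_low_orders {Δ : ℝ} (hΔ : 0 < Δ) :
    ¬ ∀ S : CorrFamily 3, (∀ n z, z ∉ NonCoincident 3 n → S n z = 0) → IsNondegenerateTwoPoint S →
      IsEuclideanInvariant S → IsScaleCovariant Δ S → HasNontrivialU4 S →
      (∀ x, limitConnectedFour S x ≤ 0) →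
      (∀ n, n ≤ 5 → ∀ x : Fin n → EuclideanSpace ℝ (Fin 3), (∀ i, x i ≠ 0) →
        S n (fun i => inversion 0 1 (x i)) = (∏ i, ‖x i‖ ^ (2 * Δ)) * S n x) →
      IsInversionCovariant Δ S := by
  intro h
  refine sixFamily_not_isInversionCovariant hΔ (h (sixFamily Δ) (sixFamily_eq_zero_of_not_mem hΔ.ne')
    (sixFamily_isNondegenerateTwoPoint Δ) (sixFamily_isEuclideanInvariant Δ) (sixFamily_isScaleCovariant Δ)
    (sixFamily_hasNontrivialU4 Δ) (limitConnectedFour_sixFamily_nonpos Δ) fun n hn x hx => ?_)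
  exact sixFamily_invIdentity_of_ne_six Δ (by omega) x hx

end Summit.CriticalPhenomena.Ising3DConformalLimit.InversionUpgradeNormalisedNegative

end
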